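import Summits.CriticalPhenomena.PercolationContinuityZ3.Theorems.PercGamblersRuinVerticalGamblersRuinStubMinimalSolution
import Summits.CriticalPhenomena.PercolationContinuityZ3.Theorems.PercGamblersRuinSymmetricSlabCalibration
import Summits.CriticalPhenomena.PercolationContinuityZ3.Theorems.PercNonProliferationFreeBoxSparseStubCeilingPath

/-!
# `stub_badSetMassOfMin` of line `registered` (crux `VerticalGamblersRuin`, stmt-CriticalPhenomena-10642):
# the bad-set mass bound transfers from the minimal lower-slab solution to every solution

Route `PercGamblersRuin` of `PercolationContinuityZ3`, skeleton rev 5 of the plate-decomposition line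
(`Cruxes/VerticalGamblersRuin/Lines/birth.lean`).  The open core of the line, `stub_badSetMassMin`, bounds
`∫_{0 ↔ ∞} u(ω,0) dP_{p_c} ≤ θ(p_c)/4` for the MINIMAL solution `u` of the lower slab `(-kn, kn)` whose
ceiling datum is the indicator of the bad plate set `{v(ω,·) < κ} ∩ {· ↔ ∞}` of a big-slab voltage field `v`.
This file proves the glue `stub_badSetMassOfMin`: the same bound for EVERY such solution `u` (measurable at
`0` only), at the cost of replacing `N` by `max N 1`.

Proof.  Let `u_m` be the minimal solution with the same datum (landed `stub_minimalSolution`: it exists, is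
measurable at every site and minimal, so the hypothesis applies to it).  For `P_{p_c}`-a.e. `ω ∈ {0 ↔ ∞}`
one has `u(ω,0) = u_m(ω,0)`: a.s. `ω` uses lattice edges only (`setBernoulli_ae_subset`), a.s. the origin
does not percolate inside the open slab `(-kn, kn)` (Barsky–Grimmett–Newman at `p_c(ℤ³)`: the slab sits in a
half-space, `FreeBoxSparse.StubCeiling.real_percolatesVia_halfSpace_depth`), and on this event two functions
that agree off the slab and are harmonic for the open lattice edges on it agree at `0`
(`SymmetricSlab.eq_of_harmonic`, Dirichlet uniqueness on the finite slab piece, which touches a plate because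
`|C(0)| = ∞`).  Hence the two restricted integrals coincide (`setIntegral_congr_ae`).

References: Barsky–Grimmett–Newman (1991); Lyons–Peres, *Probability on Trees and Networks* (2016), §2.1.
-/

noncomputable section

namespace Summit.CriticalPhenomena.PercolationContinuityZ3.Theorems.VerticalGamblersRuin

open MeasureTheory Filter Topology
open Literature.Probability.Percolation Literature.Probability.LatticeModels
open scoped Classical

namespace StubBadSetMassOfMin

/-- **BGN kill.** At `p_c(ℤ³)` the origin does not percolate inside the open slab `(-m, m)` (`m ≥ 1`):
the slab step graph is below the step graph of the half-space `{-m + 1 ≤ x₀}`, which contains `0` and does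
not percolate at `p_c` from any of its points (`FreeBoxSparse.StubCeiling.real_percolatesVia_halfSpace_depth`,
from the tree's proved `BarskyGrimmettNewman1991_Z3_holds`). -/
theorem slab_percolatesVia_null (m : ℕ) (hm : 0 < m) :
    (bondPercolation (zdGraph 3) (criticalProbI 3)).real
      (percolatesVia (withinGraph (zdGraph 3)
        {z : Site 3 | -(m : ℤ) < z 0 ∧ z 0 < (m : ℤ)}) (0 : Site 3)) = 0 := by
  -- adapted from the skeleton glue of Lines/birth.lean (lead rev 1)
  refine le_antisymm ?_ measureReal_nonneg
  calc (bondPercolation (zdGraph 3) (criticalProbI 3)).real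
        (percolatesVia (withinGraph (zdGraph 3)
          {z : Site 3 | -(m : ℤ) < z 0 ∧ z 0 < (m : ℤ)}) (0 : Site 3))
      ≤ (bondPercolation (zdGraph 3) (criticalProbI 3)).real
        (percolatesVia (withinGraph (zdGraph 3) {y : Site 3 | -(m : ℤ) + 1 ≤ y 0}) (0 : Site 3)) :=
        measureReal_mono (percolatesVia_mono_graph (withinGraph_mono (zdGraph 3)
          (fun z hz => by
            simp only [Set.mem_setOf_eq] at hz ⊢
            omega)) (0 : Site 3))
    _ = 0 := FreeBoxSparse.StubCeiling.real_percolatesVia_halfSpace_depth _ (0 : Site 3) (by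
          simp only [Pi.zero_apply]
          omega)

/-- Almost surely (for `P_{p_c}`) the origin does not percolate inside the open slab `(-m, m)`, `m ≥ 1`. -/
theorem ae_not_percolatesVia_slab (m : ℕ) (hm : 0 < m) :
    ∀ᵐ ω ∂(bondPercolation (zdGraph 3) (criticalProbI 3)),
      ω ∉ percolatesVia (withinGraph (zdGraph 3)
        {z : Site 3 | -(m : ℤ) < z 0 ∧ z 0 < (m : ℤ)}) (0 : Site 3) := by
  rw [← measure_eq_zero_iff_ae_notMem]
  exact (measureReal_eq_zero_iff (by finiteness)).1 (slab_percolatesVia_null m hm)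

/-- **Almost-sure uniqueness at the origin.**  Let `m ≥ 1` and let `u₁ u₂ : Ω → ℤ³ → ℝ` be two selections
that, for every configuration, agree off the open slab `S = {-m < x₀ < m}` and are harmonic for the open
lattice edges at every site of `S`.  Then `u₁ ω 0 = u₂ ω 0` for `P_{p_c}`-a.e. `ω ∈ {0 ↔ ∞}`
(a.s. `ω ⊆ E(ℤ³)`; a.s. the slab piece of `0` is finite, BGN; `SymmetricSlab.eq_of_harmonic`). -/
theorem ae_eq_at_zero (m : ℕ) (hm : 0 < m) {u₁ u₂ : BondConfig (Site 3) → Site 3 → ℝ}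
    (hbdry : ∀ (ω : BondConfig (Site 3)) (y : Site 3), ¬ (-(m : ℤ) < y 0 ∧ y 0 < (m : ℤ)) → u₁ ω y = u₂ ω y)
    (h₁ : ∀ (ω : BondConfig (Site 3)) (x : Site 3), -(m : ℤ) < x 0 → x 0 < (m : ℤ) →
      ∑ y ∈ ((zdGraph 3).neighborFinset x).filter (fun y => s(x, y) ∈ ω), (u₁ ω y - u₁ ω x) = 0)
    (h₂ : ∀ (ω : BondConfig (Site 3)) (x : Site 3), -(m : ℤ) < x 0 → x 0 < (m : ℤ) →
      ∑ y ∈ ((zdGraph 3).neighborFinset x).filter (fun y => s(x, y) ∈ ω), (u₂ ω y - u₂ ω x) = 0) :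
    ∀ᵐ ω ∂(bondPercolation (zdGraph 3) (criticalProbI 3)),
      ω ∈ percolatesAt (0 : Site 3) → u₁ ω 0 = u₂ ω 0 := by
  have h0 : (0 : Site 3) ∈ {z : Site 3 | -(m : ℤ) < z 0 ∧ z 0 < (m : ℤ)} := by
    simp only [Set.mem_setOf_eq, Pi.zero_apply]
    exact ⟨by omega, by omega⟩
  have hE : ∀ᵐ ω ∂(bondPercolation (zdGraph 3) (criticalProbI 3)), ω ⊆ (zdGraph 3).edgeSet :=
    ProbabilityTheory.setBernoulli_ae_subset
  filter_upwards [hE, ae_not_percolatesVia_slab m hm] with ω hωE hfin hperc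
  exact SymmetricSlab.eq_of_harmonic (S := {z : Site 3 | -(m : ℤ) < z 0 ∧ z 0 < (m : ℤ)}) h0 hωE hperc
    (Set.not_infinite.1 hfin) (fun y hy => hbdry ω y hy) (fun x hx => h₁ ω x hx.1 hx.2)
    (fun x hx => h₂ ω x hx.1 hx.2)

end StubBadSetMassOfMin

open StubBadSetMassOfMin in
/-- **stub 3b `stub_badSetMassOfMin` of line `registered` (crux `VerticalGamblersRuin`,
stmt-CriticalPhenomena-10642; provable glue, lead reshape rev 5): `stub_badSetMassMin` implies
`stub_badSetMass`.**  If, for some `k ≥ 1`, `κ > 0` and all `n ≥ N`, the MINIMAL lower-slab solution with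
ceiling datum `1_{v(ω,·) < κ ∧ · ↔ ∞}` (measurable at every site, minimal among nonnegative supersolutions)
has `∫_{0↔∞} u ≤ θ(p_c)/4` for every big-slab voltage field `v`, then so does EVERY such solution `u`
(measurable at `0`), for all `n ≥ max N 1`: the minimal solution with the same datum exists
(`stub_minimalSolution`) and agrees with `u` at `0` for a.e. `ω ∈ {0 ↔ ∞}` (`ae_eq_at_zero`). -/
theorem stub_badSetMassOfMin :
    (∃ k : ℕ, 0 < k ∧ ∃ κ : ℝ, 0 < κ ∧ ∃ N : ℕ, ∀ n ≥ N,
      ∀ v : BondConfig (Site 3) → Site 3 → ℝ, (∀ x, Measurable fun ω => v ω x) →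
        (∀ ω, (∀ x, 0 ≤ v ω x ∧ v ω x ≤ 1) ∧
          (∀ x : Site 3, (((k + 1) * n : ℕ) : ℤ) ≤ x 0 → v ω x = 1) ∧
          (∀ x : Site 3, x 0 ≤ -((k * n : ℕ) : ℤ) → v ω x = 0) ∧
          ∀ x : Site 3, -((k * n : ℕ) : ℤ) < x 0 → x 0 < (((k + 1) * n : ℕ) : ℤ) →
            ∑ y ∈ ((zdGraph 3).neighborFinset x).filter (fun y => s(x, y) ∈ ω), (v ω y - v ω x) = 0) →
        ∀ u : BondConfig (Site 3) → Site 3 → ℝ, (∀ x, Measurable fun ω => u ω x) →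
          (∀ ω, (∀ x, 0 ≤ u ω x ∧ u ω x ≤ 1) ∧
            (∀ x : Site 3, ((k * n : ℕ) : ℤ) ≤ x 0 →
              u ω x = if v ω x < κ ∧ ω ∈ percolatesAt x then 1 else 0) ∧
            (∀ x : Site 3, x 0 ≤ -((k * n : ℕ) : ℤ) → u ω x = 0) ∧
            ∀ x : Site 3, -((k * n : ℕ) : ℤ) < x 0 → x 0 < ((k * n : ℕ) : ℤ) →
              ∑ y ∈ ((zdGraph 3).neighborFinset x).filter (fun y => s(x, y) ∈ ω), (u ω y - u ω x) = 0) →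
          (∀ (ω : BondConfig (Site 3)) (f : Site 3 → ℝ), (∀ x, 0 ≤ f x) →
            (∀ x : Site 3, ((k * n : ℕ) : ℤ) ≤ x 0 →
              (if v ω x < κ ∧ ω ∈ percolatesAt x then (1 : ℝ) else 0) ≤ f x) →
            (∀ x : Site 3, -((k * n : ℕ) : ℤ) < x 0 → x 0 < ((k * n : ℕ) : ℤ) →
              ∑ y ∈ ((zdGraph 3).neighborFinset x).filter (fun y => s(x, y) ∈ ω), (f y - f x) = 0) →
            ∀ x, u ω x ≤ f x) →
          ∫ ω in percolatesAt (0 : Site 3), u ω 0 ∂(bondPercolation (zdGraph 3) (criticalProbI 3)) ≤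
            theta (zdGraph 3) (0 : Site 3) (criticalProbI 3) / 4) →
    (∃ k : ℕ, 0 < k ∧ ∃ κ : ℝ, 0 < κ ∧ ∃ N : ℕ, ∀ n ≥ N,
      ∀ v : BondConfig (Site 3) → Site 3 → ℝ, (∀ x, Measurable fun ω => v ω x) →
        (∀ ω, (∀ x, 0 ≤ v ω x ∧ v ω x ≤ 1) ∧
          (∀ x : Site 3, (((k + 1) * n : ℕ) : ℤ) ≤ x 0 → v ω x = 1) ∧
          (∀ x : Site 3, x 0 ≤ -((k * n : ℕ) : ℤ) → v ω x = 0) ∧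
          ∀ x : Site 3, -((k * n : ℕ) : ℤ) < x 0 → x 0 < (((k + 1) * n : ℕ) : ℤ) →
            ∑ y ∈ ((zdGraph 3).neighborFinset x).filter (fun y => s(x, y) ∈ ω), (v ω y - v ω x) = 0) →
        ∀ u : BondConfig (Site 3) → Site 3 → ℝ, Measurable (fun ω => u ω 0) →
          (∀ ω, (∀ x, 0 ≤ u ω x ∧ u ω x ≤ 1) ∧
            (∀ x : Site 3, ((k * n : ℕ) : ℤ) ≤ x 0 →
              u ω x = if v ω x < κ ∧ ω ∈ percolatesAt x then 1 else 0) ∧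
            (∀ x : Site 3, x 0 ≤ -((k * n : ℕ) : ℤ) → u ω x = 0) ∧
            ∀ x : Site 3, -((k * n : ℕ) : ℤ) < x 0 → x 0 < ((k * n : ℕ) : ℤ) →
              ∑ y ∈ ((zdGraph 3).neighborFinset x).filter (fun y => s(x, y) ∈ ω), (u ω y - u ω x) = 0) →
          ∫ ω in percolatesAt (0 : Site 3), u ω 0 ∂(bondPercolation (zdGraph 3) (criticalProbI 3)) ≤
            theta (zdGraph 3) (0 : Site 3) (criticalProbI 3) / 4) := by
  rintro ⟨k, hk, κ, hκ, N, hP⟩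
  refine ⟨k, hk, κ, hκ, max N 1, ?_⟩
  intro n hn v hvmeas hvsol u _ husol
  have hN : N ≤ n := le_trans (le_max_left _ _) hn
  have hn0 : 0 < n := le_trans (le_max_right _ _) hn
  have hkn : 0 < k * n := Nat.mul_pos hk hn0
  -- the indicator datum of the bad plate set is measurable at every site and `[0,1]`-valued
  have hbadm : ∀ x, MeasurableSet {ω : BondConfig (Site 3) | v ω x < κ ∧ ω ∈ percolatesAt x} := by
    intro x
    have hset : {ω : BondConfig (Site 3) | v ω x < κ ∧ ω ∈ percolatesAt x} =
        {ω : BondConfig (Site 3) | v ω x < κ} ∩ percolatesAt x := by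
      ext ω
      simp only [Set.mem_setOf_eq, Set.mem_inter_iff]
    rw [hset]
    exact (measurableSet_lt (hvmeas x) measurable_const).inter (measurableSet_percolatesAt_holds x)
  have hg : ∀ x, Measurable fun ω : BondConfig (Site 3) =>
      (if v ω x < κ ∧ ω ∈ percolatesAt x then (1 : ℝ) else 0) :=
    fun x => Measurable.ite (hbadm x) measurable_const measurable_const
  -- the minimal solution with the same datum (landed stub 1)
  obtain ⟨um, hum_meas, hum_sol, hum_min⟩ :=
    stub_minimalSolution (k * n) (k * n) hkn
      (fun ω x => if v ω x < κ ∧ ω ∈ percolatesAt x then (1 : ℝ) else 0) hg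
      (fun ω x => by
        show (0 : ℝ) ≤ (if v ω x < κ ∧ ω ∈ percolatesAt x then (1 : ℝ) else 0) ∧
          (if v ω x < κ ∧ ω ∈ percolatesAt x then (1 : ℝ) else 0) ≤ 1
        split_ifs <;> norm_num)
  -- the hypothesis bounds the minimal solution
  have hbound : ∫ ω in percolatesAt (0 : Site 3), um ω 0 ∂(bondPercolation (zdGraph 3) (criticalProbI 3)) ≤
      theta (zdGraph 3) (0 : Site 3) (criticalProbI 3) / 4 :=
    hP n hN v hvmeas hvsol um hum_meas hum_sol hum_min
  -- `u = um` at `0` for a.e. `ω ∈ {0 ↔ ∞}`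
  have hae : ∀ᵐ ω ∂(bondPercolation (zdGraph 3) (criticalProbI 3)),
      ω ∈ percolatesAt (0 : Site 3) → u ω 0 = um ω 0 := by
    refine ae_eq_at_zero (k * n) hkn (fun ω y hy => ?_)
      (fun ω x h1 h2 => (husol ω).2.2.2 x h1 h2) (fun ω x h1 h2 => (hum_sol ω).2.2.2 x h1 h2)
    rcases not_and_or.1 hy with hy | hy
    · -- floor region
      have hy' : y 0 ≤ -((k * n : ℕ) : ℤ) := not_lt.1 hy
      rw [(husol ω).2.2.1 y hy', (hum_sol ω).2.2.1 y hy']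
    · -- ceiling region
      have hy' : ((k * n : ℕ) : ℤ) ≤ y 0 := not_lt.1 hy
      rw [(husol ω).2.1 y hy', (hum_sol ω).2.1 y hy']
  calc ∫ ω in percolatesAt (0 : Site 3), u ω 0 ∂(bondPercolation (zdGraph 3) (criticalProbI 3))
      = ∫ ω in percolatesAt (0 : Site 3), um ω 0 ∂(bondPercolation (zdGraph 3) (criticalProbI 3)) :=
        setIntegral_congr_ae (measurableSet_percolatesAt_holds 0) hae
    _ ≤ theta (zdGraph 3) (0 : Site 3) (criticalProbI 3) / 4 := hbound

end Summit.CriticalPhenomena.PercolationContinuityZ3.Theorems.VerticalGamblersRuin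

end
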